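import Mathlib
import Summits.ValiantsHypothesis.ValiantsHypothesis.Theses.ValuativeGCT
import Summits.ValiantsHypothesis.ValiantsHypothesis.Theorems.CutBites.Negative.NoCutInOddDegree
import Summits.ValiantsHypothesis.ValiantsHypothesis.Theorems.CutBites.Negative.NoCutForColumnCompression
import Summits.ValiantsHypothesis.ValiantsHypothesis.Theorems.CutBites.Negative.NonVacuity

/-!
# `CutBites` — negative lemma: THE PARITY LAW OF THE NORMAL ORDER (`P_Λ^t → P_Λ^{t+1}` when `t + D` is odd)

Crux `stmt-ValiantsHypothesis-12626` (`Theses.ValuativeGCT.CutBites`, route ValuativeGCT).  Standing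
disprover (cdisprove gen 3), `Cruxes/CutBites/Disproof.lean` §G.2, def-free.  Generalises
`NoCutInOddDegree` (`t = 0`) and `EvenDegreeOrderParity` (`t = 1`) to every order `t`; the `let`-block
corollaries (`T (t+1) = T t` whenever `t + mδ` is odd) are in `NoJumpAtWrongParity`.

* `mem_vanishingIdeal_pow_succ_of_odd_add_of_rowTranspose_invariant` — a form of degree `D` on
  `End(ℂ^{m×m})`, invariant under `A ↦ A M_τ` (transpose every row) and lying in the `t`-th power of the
  vanishing ideal `P_Λ` of the skew tuples, lies in `P_Λ^{t+1}` as soon as `t + D` is odd.  Mechanism: in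
  skew/symmetric coordinates (`κ`, `θ`, inverse automorphisms) `P_Λ^t` is EXACTLY the set of forms whose
  monomials have `n`-degree `≥ t` (`κ(P_Λ) ⊆ (n-variables)` by restriction to `N = 0` and
  `MvPolynomial.funext`; powers of the monomial ideal by induction on `t`), and `M_τ` forces every
  `n`-degree to be `≡ D (mod 2)`.  So the valuative filtration of `Λ_m` jumps only at orders `≡ D (mod 2)`.
[folklore]
-/

namespace Summit.ValiantsHypothesis.ValiantsHypothesis.Theorems.CutBites.Negative

open Literature.NumberTheory.DiophantineGeometry Literature.Computability.AlgebraicComplexity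
open MvPolynomial
open scoped BigOperators Matrix

noncomputable section

/-- **Parity law of the normal order.**  For a form `G` of degree `D` on `End(ℂ^{m×m})` invariant under
`A ↦ A M_τ` (the crux's stabiliser clause at the transposition matrix): `G ∈ P_Λ^t` and `t + D` odd imply
`G ∈ P_Λ^{t+1}`, `P_Λ` the vanishing ideal of the points all of whose rows are skew. [folklore] -/
theorem mem_vanishingIdeal_pow_succ_of_odd_add_of_rowTranspose_invariant {m t D : ℕ} (hpar : Odd (t + D))
    {G : MvPolynomial (MatIdx m × MatIdx m) ℂ} (hGh : G.IsHomogeneous D)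
    (hGs : MvPolynomial.aeval (R := ℂ) (fun p : MatIdx m × MatIdx m =>
      ∑ l : MatIdx m, (Matrix.of fun l i : MatIdx m =>
        if l = toLex ((ofLex i).2, (ofLex i).1) then (1 : ℂ) else 0) l p.2 • MvPolynomial.X (p.1, l)) G = G)
    (hGv : G ∈ (MvPolynomial.vanishingIdeal ℂ {p : MatIdx m × MatIdx m → ℂ |
      ∀ j : MatIdx m, (fun i => p (j, i)) ∈ Submodule.span ℂ
        {u : MatIdx m → ℂ | ∀ a b : Fin m, u (toLex (a, b)) = -u (toLex (b, a))}}) ^ t) :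
    G ∈ (MvPolynomial.vanishingIdeal ℂ {p : MatIdx m × MatIdx m → ℂ |
      ∀ j : MatIdx m, (fun i => p (j, i)) ∈ Submodule.span ℂ
        {u : MatIdx m → ℂ | ∀ a b : Fin m, u (toLex (a, b)) = -u (toLex (b, a))}}) ^ (t + 1) := by
  -- the locus, its ideal, the row transposition
  set L : Set (MatIdx m × MatIdx m → ℂ) := {p : MatIdx m × MatIdx m → ℂ |
      ∀ j : MatIdx m, (fun i => p (j, i)) ∈ Submodule.span ℂ
        {u : MatIdx m → ℂ | ∀ a b : Fin m, u (toLex (a, b)) = -u (toLex (b, a))}} with hL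
  set P : Ideal (MvPolynomial (MatIdx m × MatIdx m) ℂ) := MvPolynomial.vanishingIdeal ℂ L with hP
  have hxsk : ∀ x ∈ L, ∀ (j : MatIdx m) (a b : Fin m), x (j, toLex (a, b)) = -x (j, toLex (b, a)) :=
    fun x hx j a b => skew_of_mem_span_skew (hx j) a b
  set sw : MatIdx m × MatIdx m → MatIdx m × MatIdx m :=
    fun p => (p.1, toLex ((ofLex p.2).2, (ofLex p.2).1)) with hsw
  have sw_sw : ∀ p, sw (sw p) = p := fun p => rfl
  have sw_eq : ∀ p : MatIdx m × MatIdx m, (ofLex p.2).1 = (ofLex p.2).2 → sw p = p := by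
    rintro ⟨j, i⟩ h
    change (ofLex i).1 = (ofLex i).2 at h
    show (j, toLex ((ofLex i).2, (ofLex i).1)) = (j, i)
    rw [← h]
    exact congrArg (fun q : Fin m × Fin m => (j, toLex q)) (Prod.ext rfl h)
  have hGs' : rename sw G = G := by
    have hre : (MvPolynomial.aeval (R := ℂ) fun p : MatIdx m × MatIdx m =>
        ∑ l : MatIdx m, (Matrix.of fun l i : MatIdx m =>
          if l = toLex ((ofLex i).2, (ofLex i).1) then (1 : ℂ) else 0) l p.2 • MvPolynomial.X (p.1, l))
        = rename sw := by
      refine MvPolynomial.algHom_ext fun p => ?_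
      rw [aeval_X, rename_X]
      exact sum_swapMatrix_smul (fun l => (X (p.1, l) : MvPolynomial (MatIdx m × MatIdx m) ℂ)) p.2
    rw [hre] at hGs
    exact hGs
  -- skew/symmetric coordinates and the auxiliary substitutions
  set κ : MatIdx m × MatIdx m → MvPolynomial (MatIdx m × MatIdx m) ℂ := fun p =>
    if (ofLex p.2).1 < (ofLex p.2).2 then C (2⁻¹ : ℂ) * (X p + X (sw p))
    else if (ofLex p.2).2 < (ofLex p.2).1 then C (2⁻¹ : ℂ) * (X p - X (sw p)) else X p with hκ
  set θ : MatIdx m × MatIdx m → MvPolynomial (MatIdx m × MatIdx m) ℂ := fun p =>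
    if (ofLex p.2).1 < (ofLex p.2).2 then X p - X (sw p)
    else if (ofLex p.2).2 < (ofLex p.2).1 then X p + X (sw p) else X p with hθ
  set ν : MatIdx m × MatIdx m → ℂ := fun p => if (ofLex p.2).1 < (ofLex p.2).2 then 1 else -1 with hν
  set ζ : MatIdx m × MatIdx m → ℂ := fun p => if (ofLex p.2).1 < (ofLex p.2).2 then 1 else 0 with hζ
  set π : MatIdx m × MatIdx m → MvPolynomial (MatIdx m × MatIdx m) ℂ := fun p =>
    if (ofLex p.2).1 < (ofLex p.2).2 then C (2⁻¹ : ℂ) * X p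
    else if (ofLex p.2).2 < (ofLex p.2).1 then -(C (2⁻¹ : ℂ) * X (sw p)) else 0 with hπ
  have κ_lt : ∀ p, (ofLex p.2).1 < (ofLex p.2).2 → κ p = C (2⁻¹ : ℂ) * (X p + X (sw p)) :=
    fun p h => by simp only [hκ, if_pos h]
  have κ_gt : ∀ p, (ofLex p.2).2 < (ofLex p.2).1 → κ p = C (2⁻¹ : ℂ) * (X p - X (sw p)) :=
    fun p h => by simp only [hκ, if_neg (not_lt_of_gt h), if_pos h]
  have κ_eq : ∀ p, (ofLex p.2).1 = (ofLex p.2).2 → κ p = X p :=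
    fun p h => by simp only [hκ, h, lt_self_iff_false, if_false]
  have θ_lt : ∀ p, (ofLex p.2).1 < (ofLex p.2).2 → θ p = X p - X (sw p) :=
    fun p h => by simp only [hθ, if_pos h]
  have θ_gt : ∀ p, (ofLex p.2).2 < (ofLex p.2).1 → θ p = X p + X (sw p) :=
    fun p h => by simp only [hθ, if_neg (not_lt_of_gt h), if_pos h]
  have θ_eq : ∀ p, (ofLex p.2).1 = (ofLex p.2).2 → θ p = X p :=
    fun p h => by simp only [hθ, h, lt_self_iff_false, if_false]
  have π_lt : ∀ p, (ofLex p.2).1 < (ofLex p.2).2 → π p = C (2⁻¹ : ℂ) * X p :=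
    fun p h => by simp only [hπ, if_pos h]
  have π_gt : ∀ p, (ofLex p.2).2 < (ofLex p.2).1 → π p = -(C (2⁻¹ : ℂ) * X (sw p)) :=
    fun p h => by simp only [hπ, if_neg (not_lt_of_gt h), if_pos h]
  have π_eq : ∀ p, (ofLex p.2).1 = (ofLex p.2).2 → π p = 0 :=
    fun p h => by simp only [hπ, h, lt_self_iff_false, if_false]
  have ν_lt : ∀ p, (ofLex p.2).1 < (ofLex p.2).2 → ν p = 1 := fun p h => by simp only [hν, if_pos h]
  have ν_nlt : ∀ p, ¬ (ofLex p.2).1 < (ofLex p.2).2 → ν p = -1 := fun p h => by simp only [hν, if_neg h]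
  have ζ_lt : ∀ p, (ofLex p.2).1 < (ofLex p.2).2 → ζ p = 1 := fun p h => by simp only [hζ, if_pos h]
  have ζ_nlt : ∀ p, ¬ (ofLex p.2).1 < (ofLex p.2).2 → ζ p = 0 := fun p h => by simp only [hζ, if_neg h]
  have h2 : C (2⁻¹ : ℂ) * 2 = (1 : MvPolynomial (MatIdx m × MatIdx m) ℂ) := by
    rw [← map_ofNat C 2, ← map_mul, inv_mul_cancel₀ two_ne_zero, map_one]
  -- (1) `θ ∘ κ = id` and `κ ∘ θ = id`
  have θκ : ∀ p, MvPolynomial.aeval (R := ℂ) θ (κ p) = X p := by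
    intro p
    rcases lt_trichotomy (ofLex p.2).1 (ofLex p.2).2 with h | h | h
    · rw [κ_lt p h, map_mul, aeval_C, algebraMap_eq, map_add, aeval_X, aeval_X, θ_lt p h,
        θ_gt (sw p) h, sw_sw]
      linear_combination (X p) * h2
    · rw [κ_eq p h, aeval_X, θ_eq p h]
    · rw [κ_gt p h, map_mul, aeval_C, algebraMap_eq, map_sub, aeval_X, aeval_X, θ_gt p h,
        θ_lt (sw p) h, sw_sw]
      linear_combination (X p) * h2
  have θκG : ∀ F, MvPolynomial.aeval (R := ℂ) θ (MvPolynomial.aeval (R := ℂ) κ F) = F := by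
    have hc : (MvPolynomial.aeval (R := ℂ) θ).comp (MvPolynomial.aeval (R := ℂ) κ)
        = AlgHom.id ℂ (MvPolynomial (MatIdx m × MatIdx m) ℂ) :=
      MvPolynomial.algHom_ext fun p => by rw [AlgHom.comp_apply, aeval_X, θκ, AlgHom.id_apply]
    intro F
    simpa using AlgHom.congr_fun hc F
  have κθ : ∀ p, MvPolynomial.aeval (R := ℂ) κ (θ p) = X p := by
    intro p
    rcases lt_trichotomy (ofLex p.2).1 (ofLex p.2).2 with h | h | h
    · rw [θ_lt p h, map_sub, aeval_X, aeval_X, κ_lt p h, κ_gt (sw p) h, sw_sw]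
      linear_combination (X p) * h2
    · rw [θ_eq p h, aeval_X, κ_eq p h]
    · rw [θ_gt p h, map_add, aeval_X, aeval_X, κ_gt p h, κ_lt (sw p) h, sw_sw]
      linear_combination (X p) * h2
  have κθG : ∀ F, MvPolynomial.aeval (R := ℂ) κ (MvPolynomial.aeval (R := ℂ) θ F) = F := by
    have hc : (MvPolynomial.aeval (R := ℂ) κ).comp (MvPolynomial.aeval (R := ℂ) θ)
        = AlgHom.id ℂ (MvPolynomial (MatIdx m × MatIdx m) ℂ) :=
      MvPolynomial.algHom_ext fun p => by rw [AlgHom.comp_apply, aeval_X, κθ, AlgHom.id_apply]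
    intro F
    simpa using AlgHom.congr_fun hc F
  -- (2) the normal reflection: `ν (κ F) = κ (negate ∘ transpose rows) F`
  have νκ : ∀ p, MvPolynomial.aeval (R := ℂ) (fun q => ν q • (X q : MvPolynomial (MatIdx m × MatIdx m) ℂ)) (κ p)
      = MvPolynomial.aeval (R := ℂ) κ ((-1 : ℂ) • (X (sw p) : MvPolynomial (MatIdx m × MatIdx m) ℂ)) := by
    intro p
    rcases lt_trichotomy (ofLex p.2).1 (ofLex p.2).2 with h | h | h
    · rw [κ_lt p h]
      simp only [map_mul, map_add, aeval_C, algebraMap_eq, aeval_X, smul_eq_C_mul]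
      rw [ν_lt p h, ν_nlt (sw p) (not_lt_of_gt h), κ_gt (sw p) h, sw_sw]
      simp only [map_one, map_neg]
      ring
    · rw [κ_eq p h]
      simp only [aeval_X, smul_eq_C_mul, map_mul, aeval_C, algebraMap_eq]
      rw [ν_nlt p (by rw [h]; exact lt_irrefl _), sw_eq p h, κ_eq p h]
    · rw [κ_gt p h]
      simp only [map_mul, map_sub, aeval_C, algebraMap_eq, aeval_X, smul_eq_C_mul]
      rw [ν_nlt p (not_lt_of_gt h), ν_lt (sw p) h, κ_lt (sw p) h, sw_sw]
      simp only [map_one, map_neg]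
      ring
  -- (3) the restriction to `N = 0`
  have ζκ : ∀ p, MvPolynomial.aeval (R := ℂ) (fun q => ζ q • (X q : MvPolynomial (MatIdx m × MatIdx m) ℂ)) (κ p)
      = π p := by
    intro p
    rcases lt_trichotomy (ofLex p.2).1 (ofLex p.2).2 with h | h | h
    · rw [κ_lt p h]
      simp only [map_mul, map_add, aeval_C, algebraMap_eq, aeval_X]
      rw [ζ_lt p h, ζ_nlt (sw p) (not_lt_of_gt h), π_lt p h]
      simp only [one_smul, zero_smul, add_zero]
    · rw [κ_eq p h, aeval_X, ζ_nlt p (by rw [h]; exact lt_irrefl _), π_eq p h, zero_smul]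
    · rw [κ_gt p h]
      simp only [map_mul, map_sub, aeval_C, algebraMap_eq, aeval_X]
      rw [ζ_nlt p (not_lt_of_gt h), ζ_lt (sw p) h, π_gt p h]
      simp only [one_smul, zero_smul, zero_sub, mul_neg]
  have πL : ∀ x : MatIdx m × MatIdx m → ℂ, (fun p => MvPolynomial.eval x (π p)) ∈ L := by
    intro x j
    refine Submodule.subset_span fun a b => ?_
    rcases lt_trichotomy a b with h | h | h
    · have h1 : (ofLex ((j, toLex (a, b)) : MatIdx m × MatIdx m).2).1
          < (ofLex ((j, toLex (a, b)) : MatIdx m × MatIdx m).2).2 := h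
      have h2 : (ofLex ((j, toLex (b, a)) : MatIdx m × MatIdx m).2).2
          < (ofLex ((j, toLex (b, a)) : MatIdx m × MatIdx m).2).1 := h
      simp only [π_lt _ h1, π_gt _ h2, map_neg, map_mul, eval_C, eval_X, neg_neg]
      rfl
    · subst h
      have h1 : (ofLex ((j, toLex (a, a)) : MatIdx m × MatIdx m).2).1
          = (ofLex ((j, toLex (a, a)) : MatIdx m × MatIdx m).2).2 := rfl
      simp only [π_eq _ h1, map_zero, neg_zero]
    · have h1 : (ofLex ((j, toLex (a, b)) : MatIdx m × MatIdx m).2).2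
          < (ofLex ((j, toLex (a, b)) : MatIdx m × MatIdx m).2).1 := h
      have h2 : (ofLex ((j, toLex (b, a)) : MatIdx m × MatIdx m).2).1
          < (ofLex ((j, toLex (b, a)) : MatIdx m × MatIdx m).2).2 := h
      simp only [π_gt _ h1, π_lt _ h2, map_neg, map_mul, eval_C, eval_X]
      rfl
  -- `n`-degree of an exponent vector, its additivity, and the two sign products
  have nDeg_add : ∀ α β : MatIdx m × MatIdx m →₀ ℕ,
      (∑ p ∈ (α + β).support with ¬ (ofLex p.2).1 < (ofLex p.2).2, (α + β) p)
        = (∑ p ∈ α.support with ¬ (ofLex p.2).1 < (ofLex p.2).2, α p)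
          + (∑ p ∈ β.support with ¬ (ofLex p.2).1 < (ofLex p.2).2, β p) := by
    have huniv : ∀ γ : MatIdx m × MatIdx m →₀ ℕ,
        (∑ p ∈ γ.support with ¬ (ofLex p.2).1 < (ofLex p.2).2, γ p)
          = ∑ p ∈ (Finset.univ : Finset (MatIdx m × MatIdx m)) with ¬ (ofLex p.2).1 < (ofLex p.2).2, γ p := by
      intro γ
      refine Finset.sum_subset (Finset.filter_subset_filter _ (Finset.subset_univ _)) fun q hq hqs => ?_
      by_contra h
      exact hqs (Finset.mem_filter.mpr ⟨Finsupp.mem_support_iff.mpr h, (Finset.mem_filter.mp hq).2⟩)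
    intro α β
    rw [huniv (α + β), huniv α, huniv β, ← Finset.sum_add_distrib]
    rfl
  have prod_ν : ∀ α : MatIdx m × MatIdx m →₀ ℕ, ∏ p ∈ α.support, ν p ^ α p
      = (-1) ^ (∑ p ∈ α.support with ¬ (ofLex p.2).1 < (ofLex p.2).2, α p) := by
    intro α
    rw [← Finset.prod_filter_mul_prod_filter_not α.support (fun p => (ofLex p.2).1 < (ofLex p.2).2),
      Finset.prod_eq_one (fun p hp => by rw [ν_lt p (Finset.mem_filter.mp hp).2, one_pow]),
      one_mul, ← Finset.prod_pow_eq_pow_sum]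
    exact Finset.prod_congr rfl fun p hp => by rw [ν_nlt p (Finset.mem_filter.mp hp).2]
  have prod_ζ : ∀ α : MatIdx m × MatIdx m →₀ ℕ, ∏ p ∈ α.support, ζ p ^ α p
      = if (∑ p ∈ α.support with ¬ (ofLex p.2).1 < (ofLex p.2).2, α p) = 0 then 1 else 0 := by
    intro α
    rw [← Finset.prod_filter_mul_prod_filter_not α.support (fun p => (ofLex p.2).1 < (ofLex p.2).2),
      Finset.prod_eq_one (fun p hp => by rw [ζ_lt p (Finset.mem_filter.mp hp).2, one_pow]),
      one_mul]
    by_cases h0 : (∑ p ∈ α.support with ¬ (ofLex p.2).1 < (ofLex p.2).2, α p) = 0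
    · rw [if_pos h0]
      refine Finset.prod_eq_one fun p hp => ?_
      exfalso
      have hmem := Finset.mem_filter.mp hp
      have hpos : 0 < α p := Nat.pos_of_ne_zero (Finsupp.mem_support_iff.mp hmem.1)
      have hle : α p ≤ ∑ p ∈ α.support with ¬ (ofLex p.2).1 < (ofLex p.2).2, α p :=
        Finset.single_le_sum (f := fun p => α p) (fun _ _ => Nat.zero_le _) hp
      omega
    · rw [if_neg h0]
      obtain ⟨p, hp, hαp⟩ := Finset.exists_ne_zero_of_sum_ne_zero h0
      exact Finset.prod_eq_zero hp (by rw [ζ_nlt p (Finset.mem_filter.mp hp).2, zero_pow hαp])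
  -- the `n`-coordinates vanish on `L`
  have θP : ∀ p : MatIdx m × MatIdx m, ¬ (ofLex p.2).1 < (ofLex p.2).2 → θ p ∈ P := by
    rintro ⟨j, i⟩ hp
    rw [hP, mem_vanishingIdeal_iff]
    intro x hx
    have hsk := hxsk x hx j (ofLex i).1 (ofLex i).2
    have hi : toLex ((ofLex i).1, (ofLex i).2) = i := rfl
    rw [hi] at hsk
    rcases (not_lt.mp hp).lt_or_eq with h | h
    · have h' : (ofLex ((j, i) : MatIdx m × MatIdx m).2).2 < (ofLex ((j, i) : MatIdx m × MatIdx m).2).1 := h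
      rw [θ_gt _ h', map_add, aeval_X, aeval_X]
      change x (j, i) + x (j, toLex ((ofLex i).2, (ofLex i).1)) = 0
      rw [hsk]
      ring
    · have h' : (ofLex ((j, i) : MatIdx m × MatIdx m).2).1 = (ofLex ((j, i) : MatIdx m × MatIdx m).2).2 :=
        h.symm
      rw [θ_eq _ h', aeval_X]
      change x (j, i) = 0
      have hii : toLex ((ofLex i).2, (ofLex i).1) = i := congrArg Prod.snd (sw_eq (j, i) h')
      rw [hii] at hsk
      linear_combination hsk / 2
  -- (4) `κ(P) ⊆ (n-variables)`: restriction to `N = 0` and `MvPolynomial.funext`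
  set N : Ideal (MvPolynomial (MatIdx m × MatIdx m) ℂ) := Ideal.span
    ((fun q => (X q : MvPolynomial (MatIdx m × MatIdx m) ℂ)) ''
      {q : MatIdx m × MatIdx m | ¬ (ofLex q.2).1 < (ofLex q.2).2}) with hN
  have κP : ∀ F ∈ P, MvPolynomial.aeval (R := ℂ) κ F ∈ N := by
    intro F hF
    have hb : MvPolynomial.aeval (R := ℂ) (fun q => ζ q • (X q : MvPolynomial (MatIdx m × MatIdx m) ℂ))
        (MvPolynomial.aeval (R := ℂ) κ F) = 0 := by
      have hc : (MvPolynomial.aeval (R := ℂ)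
            (fun q => ζ q • (X q : MvPolynomial (MatIdx m × MatIdx m) ℂ))).comp (MvPolynomial.aeval (R := ℂ) κ)
          = MvPolynomial.aeval (R := ℂ) π :=
        MvPolynomial.algHom_ext fun p => by rw [AlgHom.comp_apply, aeval_X, aeval_X, ζκ]
      have h := AlgHom.congr_fun hc F
      rw [AlgHom.comp_apply] at h
      rw [h]
      refine MvPolynomial.funext fun x => ?_
      rw [map_zero]
      have hcomp := AlgHom.congr_fun (MvPolynomial.comp_aeval π (MvPolynomial.aeval (R := ℂ) x)) F
      rw [AlgHom.comp_apply] at hcomp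
      have hF0 := hF
      rw [hP, mem_vanishingIdeal_iff] at hF0
      have key : MvPolynomial.aeval (R := ℂ) x (MvPolynomial.aeval (R := ℂ) π F) = 0 :=
        hcomp.trans (hF0 _ (πL x))
      simpa [MvPolynomial.coe_aeval_eq_eval] using key
    rw [hN, mem_ideal_span_X_image]
    intro α hα
    have hne : coeff α (MvPolynomial.aeval (R := ℂ) κ F) ≠ 0 := mem_support_iff.mp hα
    have h3 := congrArg (coeff α) hb
    rw [coeff_aeval_smul_X, prod_ζ, coeff_zero] at h3
    have hn0 : (∑ p ∈ α.support with ¬ (ofLex p.2).1 < (ofLex p.2).2, α p) ≠ 0 := by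
      intro h0
      rw [if_pos h0, one_mul] at h3
      exact hne h3
    obtain ⟨q, hq, hαq⟩ := Finset.exists_ne_zero_of_sum_ne_zero hn0
    exact ⟨q, (Finset.mem_filter.mp hq).2, hαq⟩
  -- (5) elements of `N^s` have all monomials of `n`-degree `≥ s`
  have Npow : ∀ (s : ℕ) (F : MvPolynomial (MatIdx m × MatIdx m) ℂ), F ∈ N ^ s →
      ∀ α ∈ F.support, s ≤ ∑ p ∈ α.support with ¬ (ofLex p.2).1 < (ofLex p.2).2, α p := by
    intro s
    induction s with
    | zero => intro F _ α _; exact Nat.zero_le _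
    | succ s ih =>
      intro F hF
      rw [pow_succ] at hF
      refine Submodule.mul_induction_on hF ?_ ?_
      · intro f hf g hg α hα
        have hsub := MvPolynomial.support_mul f g hα
        obtain ⟨β, hβ, γ, hγ, rfl⟩ := Finset.mem_add.mp hsub
        have h1 := ih f hf β hβ
        have h2 : 1 ≤ ∑ p ∈ γ.support with ¬ (ofLex p.2).1 < (ofLex p.2).2, γ p := by
          rw [hN, mem_ideal_span_X_image] at hg
          obtain ⟨q, hq, hγq⟩ := hg γ hγ
          have hle : γ q ≤ ∑ p ∈ γ.support with ¬ (ofLex p.2).1 < (ofLex p.2).2, γ p :=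
            Finset.single_le_sum (f := fun p => γ p) (fun _ _ => Nat.zero_le _)
              (Finset.mem_filter.mpr ⟨Finsupp.mem_support_iff.mpr hγq, hq⟩)
          have hpos : 0 < γ q := Nat.pos_of_ne_zero hγq
          omega
        rw [nDeg_add]
        omega
      · intro x y hx hy α hα
        rcases Finset.mem_union.mp (MvPolynomial.support_add hα) with h | h
        · exact hx α h
        · exact hy α h
  -- (6) `G' := κ G ∈ N^t`, so its `n`-degrees are `≥ t`; by `M_τ` they are `≡ D (mod 2)`, hence `≥ t + 1`
  set G' := MvPolynomial.aeval (R := ℂ) κ G with hG'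
  have hG'N : G' ∈ N ^ t := by
    have hmap : Ideal.map (MvPolynomial.aeval (R := ℂ) κ) P ≤ N :=
      Ideal.map_le_iff_le_comap.mpr fun F hF => κP F hF
    have h := Ideal.mem_map_of_mem (MvPolynomial.aeval (R := ℂ) κ) hGv
    rw [Ideal.map_pow] at h
    exact Ideal.pow_right_mono hmap t h
  have ha : MvPolynomial.aeval (R := ℂ) (fun q => ν q • (X q : MvPolynomial (MatIdx m × MatIdx m) ℂ)) G'
      = C ((-1 : ℂ) ^ D) * G' := by
    have hc : (MvPolynomial.aeval (R := ℂ)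
          (fun q => ν q • (X q : MvPolynomial (MatIdx m × MatIdx m) ℂ))).comp (MvPolynomial.aeval (R := ℂ) κ)
        = (MvPolynomial.aeval (R := ℂ) κ).comp (MvPolynomial.aeval (R := ℂ) fun p =>
            (-1 : ℂ) • (X (sw p) : MvPolynomial (MatIdx m × MatIdx m) ℂ)) :=
      MvPolynomial.algHom_ext fun p => by rw [AlgHom.comp_apply, AlgHom.comp_apply, aeval_X, aeval_X, νκ]
    have h := AlgHom.congr_fun hc G
    rw [AlgHom.comp_apply, AlgHom.comp_apply] at h
    rw [hG', h, aeval_smul_X_of_isHomogeneous hGh (-1) sw, hGs', map_mul, aeval_C, algebraMap_eq]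
  have hdeg : ∀ α ∈ G'.support, t + 1 ≤ ∑ p ∈ α.support with ¬ (ofLex p.2).1 < (ofLex p.2).2, α p := by
    intro α hα
    have hle := Npow t G' hG'N α hα
    rcases hle.lt_or_eq with hlt | heq
    · exact hlt
    · exfalso
      have hne : coeff α G' ≠ 0 := mem_support_iff.mp hα
      have h1 := congrArg (coeff α) ha
      rw [coeff_aeval_smul_X, prod_ν, coeff_C_mul, ← heq] at h1
      -- `(-1)^t c = (-1)^D c` with `t + D` odd forces `c = 0`
      have h3 : ((-1 : ℂ) ^ t * (-1) ^ t) * coeff α G' = (-1 : ℂ) ^ (t + D) * coeff α G' := by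
        rw [mul_assoc, h1, ← mul_assoc, ← pow_add]
      rw [← pow_add, ← two_mul, pow_mul, neg_one_sq, one_pow, one_mul, hpar.neg_one_pow, neg_one_mul] at h3
      exact hne (by linear_combination h3 / 2)
  -- (7) back to old coordinates
  rw [← θκG G]
  change MvPolynomial.aeval (R := ℂ) θ G' ∈ P ^ (t + 1)
  rw [G'.as_sum, map_sum]
  refine Ideal.sum_mem _ fun α hα => ?_
  rw [aeval_monomial, Finsupp.prod,
    ← Finset.prod_filter_mul_prod_filter_not α.support (fun p => (ofLex p.2).1 < (ofLex p.2).2)]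
  refine Ideal.mul_mem_left _ _ (Ideal.mul_mem_left _ _ ?_)
  refine Ideal.pow_le_pow_right (hdeg α hα) ?_
  rw [← Finset.prod_pow_eq_pow_sum]
  exact Ideal.prod_mem_prod fun p hp => Ideal.pow_mem_pow (θP p (Finset.mem_filter.mp hp).2) _

end

end Summit.ValiantsHypothesis.ValiantsHypothesis.Theorems.CutBites.Negative
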